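/- Fleet seat `ym-wcr-19608-p2` (g2), route `WeakCouplingRates`, cruxes `ColdBoxTwoPointFloorW` (stmt-QuantumFields-19608) and
`BulkDominatesColdBoxW` (stmt-QuantumFields-19609): the ϑ-DATUM pass of the one-scale trunk, THE REPRESENTATION WITH DATUM (T3). -/
import Summits.QuantumFields.YangMills.Theorems.WeakCouplingRatesColdBoxTiltBoundDatum
import Summits.QuantumFields.YangMills.Theorems.WeakCouplingRatesColdBoxRepresentation
import Summits.QuantumFields.YangMills.Theorems.WeakCouplingRatesBulkDominatesColdBoxWForestGaugeDatum
import Summits.QuantumFields.YangMills.Theorems.WeakCouplingRatesBulkDominatesColdBoxWKernelGoodEvent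

/-!
# The one-scale expansion with an exterior datum: the REPRESENTATION of the small-field conditioned DLR box kernel as a bounded tilt of the
# conditioned product Dirichlet Gaussian (T3)

The ϑ-twin of `integral_cond_boxState_eq_integral_tilted` (`…ColdBoxRepresentation`, fleet lead `ym-wcr-19456-p1` g2) — the trunk theorem of
the datum pass (stub-critic STUB-PLAN rev 2 §T3, evidence #34 on stmt-QuantumFields-19609), consumed by the 19609 read-outs
`kernelCovExpansion_of_trunk` / `kernelMeanExpansion_of_trunk` (stubs `stub_kernelCovExpansion`, `stub_kernelMeanExpansion`).

**`integral_cond_boxKernel_eq_integral_tilted_datum`.**  Let the exterior datum `W` have links `W e = P(1, ϑ_e)` with `Σ_c ϑ_{c,e}² ≤ r²` for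
every `e` off the cold box `Λ = boxEdges 4 (2H+1)`, inside the window `(12H²+2H+1)(√(β^{2ε−1}) + 8r) ≤ 1` (`β > 0`, `H ≥ 1`, `r ≥ 0`), and
assume `γ_Λ(·|W)(G) ≠ 0`, `gauss3(goodTD) ≠ 0` (`G = coldGoodSet β ε H`).  Then for every measurable gauge-invariant `X ≥ 0`,
`∫ X d(γ_Λ(·|W)[|G]) = ∫ X(cfgTD β ϑ t) d(((gauss3 H)[|goodTD H β ε ϑ]).tilted (𝟙_{goodTD}·tiltWD H β ϑ))(t)`:
the kernel conditioned on the small-field event is the `e^{tiltWD}`-tilt of the conditioned, UNshifted `boxDirichlet H ^{⊗3}` read through the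
chart configuration with datum (the harmonic mean shift `μ' = mean ϑ'` sits inside `cfgTD`).
Chain = the flat chain with three substitutions: the datum forest gauge `integral_ymSpecification_box_eq_coldFree` (M1) for
`integral_boxState_eq_coldFree`; the Poincaré ladder with small exterior (`su2_opDist1_le_of_cost_le_of_exterior_le`) for R1, so that on `G` every
free link is in the upper hemisphere and the product gnomonic chart `lintegral_pi_haar_eq_gnomonic` applies, the glued configuration being
`chartCfgD ϑ w` (`glueWith_coldExt₁_gnomonicChart`); and, on the Gaussian side, the change of variables `w = unscaleT β (t + μ')` (constant
Jacobian × a Lebesgue translation, `exists_lintegral_eq_mul_lintegral_unscaleT_add`) followed by the density identity with datum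
(`exists_boltzmann_mul_gnomonicDensity_datum_eq`: completing the square per colour leaves the centred Gaussian weight times a constant) and
`lintegral_mul_prod_gaussWeight_eq`.  All constants (`a`, `C`, `Z³`) cancel in the ratio (`integral_tilted_cond_eq_ratio`).  No hypothesis on the
forest values of `ϑ` is needed here (they only enter the SIZE of the tilt, `abs_tiltWD_le_of_mem_goodTD`).
No sorry; no new definition; standard axioms.  NOT a claim about the mass gap.
-/

set_option autoImplicit false

set_option synthInstance.maxSize 4096

noncomputable section

open MeasureTheory ProbabilityTheory Finset
open scoped ENNReal
open Literature.Probability.LatticeModels (Site glueWith glueWith_apply_mem glueWith_apply_not_mem measurable_glueWith)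
open Literature.MathematicalPhysics
open Literature.MathematicalPhysics.QuantumLattice
open Literature.MathematicalPhysics.QuantumFieldTheory
open Literature.MathematicalPhysics.QuantumFieldTheory.LatticeMaxwell
open Literature.MathematicalPhysics.QuantumFieldTheory.AxialGauge
open Literature.MathematicalPhysics.QuantumFieldTheory.GaussianToolkit
open Literature.MathematicalPhysics.QuantumFieldTheory.Balaban1983to89
open Literature.MathematicalPhysics.QuantumFieldTheory.Balaban1983to89.UnitaryModel

namespace Summit.QuantumFields.YangMills.Theorems.WeakCouplingRates

variable {H : ℕ}

/-! ## Step 1 (datum): conditional kernel expectations as ratios of free-link integrals -/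

/-- The free-link integral with datum `N_W(Ψ) = ∫ Ψ(U_v^W) e^{−βS_Λ(U_v^W)} dσ^{free}(v)` of the temporal-forest gauge, `U_v^W = glueWith Λ (coldExt₁ v) W`
(as an expression): kernel expectations of `𝟙_G·X` for gauge-invariant `X`. -/
theorem integral_boxKernel_indicator_eq (β ε : ℝ) (H : ℕ) (W : LGConfig 4 (Matrix.specialUnitaryGroup (Fin 2) ℂ))
    {X : LGConfig 4 (Matrix.specialUnitaryGroup (Fin 2) ℂ) → ℝ} (hXm : Measurable X) (hX : IsZdGaugeInvariant X) :
    ∫ U, (coldGoodSet β ε H).indicator X U ∂(boxKernel β H W) =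
      (∫ v, (coldGoodSet β ε H).indicator X (glueWith (boxEdges 4 (2 * H + 1)) (coldExt₁ v) W) *
          Real.exp (-β * wilsonBoundaryAction (fundamentalRep (Fin 2)) (boxEdges 4 (2 * H + 1))
            (glueWith (boxEdges 4 (2 * H + 1)) (coldExt₁ v) W))
        ∂(Measure.pi fun _ : ColdFreeIdx H => haarProbability (Matrix.specialUnitaryGroup (Fin 2) ℂ))) /
      ∫ v, Real.exp (-β * wilsonBoundaryAction (fundamentalRep (Fin 2)) (boxEdges 4 (2 * H + 1))
            (glueWith (boxEdges 4 (2 * H + 1)) (coldExt₁ v) W))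
        ∂(Measure.pi fun _ : ColdFreeIdx H => haarProbability (Matrix.specialUnitaryGroup (Fin 2) ℂ)) :=
  integral_ymSpecification_box_eq_coldFree _ (continuous_fundamentalRep (Fin 2)) β H W (hXm.indicator (measurableSet_coldGoodSet β ε H))
    (isZdGaugeInvariant_indicator_coldGoodSet β ε hX)

/-- **Step 1 (datum).**  `E_{γ(·|W)[|G]}[X] = N_W(𝟙_G X) / N_W(𝟙_G)` for measurable gauge-invariant `X` (`G = coldGoodSet β ε H`, `γ(·|W)(G) ≠ 0`). -/
theorem integral_cond_boxKernel_eq_ratio (β ε : ℝ) (H : ℕ) (W : LGConfig 4 (Matrix.specialUnitaryGroup (Fin 2) ℂ))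
    (hG0 : boxKernel β H W (coldGoodSet β ε H) ≠ 0)
    {X : LGConfig 4 (Matrix.specialUnitaryGroup (Fin 2) ℂ) → ℝ} (hXm : Measurable X) (hX : IsZdGaugeInvariant X) :
    ∫ U, X U ∂((boxKernel β H W)[|coldGoodSet β ε H]) =
      (∫ v, (coldGoodSet β ε H).indicator X (glueWith (boxEdges 4 (2 * H + 1)) (coldExt₁ v) W) *
          Real.exp (-β * wilsonBoundaryAction (fundamentalRep (Fin 2)) (boxEdges 4 (2 * H + 1))
            (glueWith (boxEdges 4 (2 * H + 1)) (coldExt₁ v) W))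
        ∂(Measure.pi fun _ : ColdFreeIdx H => haarProbability (Matrix.specialUnitaryGroup (Fin 2) ℂ))) /
      ∫ v, (coldGoodSet β ε H).indicator (fun _ => (1 : ℝ)) (glueWith (boxEdges 4 (2 * H + 1)) (coldExt₁ v) W) *
          Real.exp (-β * wilsonBoundaryAction (fundamentalRep (Fin 2)) (boxEdges 4 (2 * H + 1))
            (glueWith (boxEdges 4 (2 * H + 1)) (coldExt₁ v) W))
        ∂(Measure.pi fun _ : ColdFreeIdx H => haarProbability (Matrix.specialUnitaryGroup (Fin 2) ℂ)) := by
  haveI := isProbabilityMeasure_boxKernel β H W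
  set μ := boxKernel β H W with hμ
  set G := coldGoodSet β ε H with hG
  have hGm : MeasurableSet G := measurableSet_coldGoodSet β ε H
  have hnum : ∫ U in G, X U ∂μ = ∫ U, G.indicator X U ∂μ := (integral_indicator hGm).symm
  have hmass : μ.real G = ∫ U, G.indicator (fun _ => (1 : ℝ)) U ∂μ := by
    rw [integral_indicator hGm, setIntegral_const, smul_eq_mul, mul_one]
  rw [integral_cond_eq, hnum, hmass, hG, integral_boxKernel_indicator_eq β ε H W hXm hX,
    integral_boxKernel_indicator_eq β ε H W measurable_const (fun _ _ => rfl)]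
  set A := ∫ v, (coldGoodSet β ε H).indicator X (glueWith (boxEdges 4 (2 * H + 1)) (coldExt₁ v) W) *
      Real.exp (-β * wilsonBoundaryAction (fundamentalRep (Fin 2)) (boxEdges 4 (2 * H + 1)) (glueWith (boxEdges 4 (2 * H + 1)) (coldExt₁ v) W))
    ∂(Measure.pi fun _ : ColdFreeIdx H => haarProbability (Matrix.specialUnitaryGroup (Fin 2) ℂ)) with hA
  set B := ∫ v, (coldGoodSet β ε H).indicator (fun _ => (1 : ℝ)) (glueWith (boxEdges 4 (2 * H + 1)) (coldExt₁ v) W) *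
      Real.exp (-β * wilsonBoundaryAction (fundamentalRep (Fin 2)) (boxEdges 4 (2 * H + 1)) (glueWith (boxEdges 4 (2 * H + 1)) (coldExt₁ v) W))
    ∂(Measure.pi fun _ : ColdFreeIdx H => haarProbability (Matrix.specialUnitaryGroup (Fin 2) ℂ)) with hB
  set Z := ∫ v, Real.exp (-β * wilsonBoundaryAction (fundamentalRep (Fin 2)) (boxEdges 4 (2 * H + 1))
      (glueWith (boxEdges 4 (2 * H + 1)) (coldExt₁ v) W))
    ∂(Measure.pi fun _ : ColdFreeIdx H => haarProbability (Matrix.specialUnitaryGroup (Fin 2) ℂ)) with hZ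
  have hBZ : B / Z = μ.real G := by
    rw [hmass, hG, integral_boxKernel_indicator_eq β ε H W measurable_const (fun _ _ => rfl)]
  have hreal : μ.real G ≠ 0 := by
    rw [measureReal_def]; exact ENNReal.toReal_ne_zero.2 ⟨hG0, measure_ne_top _ _⟩
  have hB0 : B ≠ 0 := fun h => hreal (by rw [← hBZ, h, zero_div])
  have hZ0 : Z ≠ 0 := fun h => hreal (by rw [← hBZ, h, div_zero])
  field_simp

/-! ## Step 2 (datum): the free-link integrals in the product gnomonic chart -/

/-- On the small-field event, with exterior links `P(1, ϑ_e)`, `Σ_c ϑ_{c,e}² ≤ r²`, every FREE link of the glued configuration is in the upper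
hemisphere, given the window `(12H²+2H+1)(√(β^{2ε−1}) + 8r) ≤ 1`. -/
theorem re_trace_pos_of_mem_coldGoodSet_datum {β ε r : ℝ} (hβ : 0 < β) (hH : 1 ≤ H) (hr : 0 ≤ r)
    (hwin : (12 * (H : ℝ) ^ 2 + 2 * H + 1) * (Real.sqrt (β ^ (2 * ε - 1)) + 8 * r) ≤ 1)
    {W : LGConfig 4 (Matrix.specialUnitaryGroup (Fin 2) ℂ)} {ϑ : Fin 3 → (Literature.MathematicalPhysics.QuantumLattice.ZdEdge 4 → ℝ)}
    (hW : ∀ e, e ∉ boxEdges 4 (2 * H + 1) → W e = gnomonicChart (fun c => ϑ c e))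
    (hϑ : ∀ e, e ∉ boxEdges 4 (2 * H + 1) → ∑ c, ϑ c e ^ 2 ≤ r ^ 2)
    (v : ColdFreeCfg (G := Matrix.specialUnitaryGroup (Fin 2) ℂ) H)
    (hv : glueWith (boxEdges 4 (2 * H + 1)) (coldExt₁ v) W ∈ coldGoodSet β ε H) (e : ColdFreeIdx H) :
    0 < (((v e : Matrix.specialUnitaryGroup (Fin 2) ℂ) : Matrix (Fin 2) (Fin 2) ℂ).trace).re := by
  set V := glueWith (boxEdges 4 (2 * H + 1)) (coldExt₁ v) W with hV
  have hcost : ∀ p ∈ plaquettesTouching (boxEdges 4 (2 * H + 1)),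
      plaqCostAt (fundamentalRep (Fin 2)) p.1 p.2.1.1 p.2.1.2 V ≤ Real.sqrt (β ^ (2 * ε - 1)) ^ 2 := by
    intro p hp
    rw [Real.sq_sqrt (Real.rpow_nonneg hβ.le _)]
    exact ((mem_coldGoodSet_iff β ε V).1 hv p hp).le
  have hout : ∀ e, e ∉ boxEdges 4 (2 * H + 1) → opDist1 (fundamentalRep (Fin 2) (V e)) ≤ r := by
    intro e he
    rw [hV, glueWith_apply_not_mem _ _ _ he, hW e he]
    exact opDist1_gnomonicChart_le hr (hϑ e he)
  have hforest : ∀ x : Site 4, (∀ k : Fin 4, 1 ≤ x k ∧ x k + 1 ≤ 2 * (H : ℤ)) → V (x, 0) = 1 := by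
    intro x hx
    have hmem : (x, (0 : Fin 4)) ∈ boxEdges 4 (2 * H + 1) := by
      rw [mem_boxEdges_iff]
      refine ⟨fun k => ⟨by linarith [(hx k).1], ?_⟩, ?_⟩
      · have := (hx k).2; push_cast; omega
      · have := (hx 0).2; push_cast; omega
    rw [hV, glueWith_apply_mem _ _ _ hmem, coldExt₁, dif_pos ⟨rfl, hx⟩]
  have hlink := su2_opDist1_le_of_cost_le_of_exterior_le hH V hr (Real.sqrt_nonneg _) hout hforest hcost e.1.1
  have hcostlink := cost_le_of_opDist1_fundamentalRep_le (hlink.trans hwin)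
  have hVe : V e.1.1 = v e := by
    rw [hV, glueWith_apply_mem _ _ _ e.1.2, coldExt₁, dif_neg e.2]
  rw [hVe] at hcostlink
  linarith

/-- **Step 2 (datum).**  For measurable `Ψ ≥ 0`:
`N_W(𝟙_G Ψ) = (∫⁻ 𝟙_G(chartCfgD ϑ w) Ψ(chartCfgD ϑ w) e^{−βS(chartCfgD ϑ w)} Π_e gnomonicDensity(w_e) dw).toReal`. -/
theorem freeIntegral_indicator_eq_lintegral_chart_datum {β ε r : ℝ} (hβ : 0 < β) (hH : 1 ≤ H) (hr : 0 ≤ r)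
    (hwin : (12 * (H : ℝ) ^ 2 + 2 * H + 1) * (Real.sqrt (β ^ (2 * ε - 1)) + 8 * r) ≤ 1)
    {W : LGConfig 4 (Matrix.specialUnitaryGroup (Fin 2) ℂ)} {ϑ : Fin 3 → (Literature.MathematicalPhysics.QuantumLattice.ZdEdge 4 → ℝ)}
    (hW : ∀ e, e ∉ boxEdges 4 (2 * H + 1) → W e = gnomonicChart (fun c => ϑ c e))
    (hϑ : ∀ e, e ∉ boxEdges 4 (2 * H + 1) → ∑ c, ϑ c e ^ 2 ≤ r ^ 2)
    {Ψ : LGConfig 4 (Matrix.specialUnitaryGroup (Fin 2) ℂ) → ℝ} (hΨm : Measurable Ψ) (hΨ0 : ∀ U, 0 ≤ Ψ U) :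
    ∫ v, (coldGoodSet β ε H).indicator Ψ (glueWith (boxEdges 4 (2 * H + 1)) (coldExt₁ v) W) *
          Real.exp (-β * wilsonBoundaryAction (fundamentalRep (Fin 2)) (boxEdges 4 (2 * H + 1))
            (glueWith (boxEdges 4 (2 * H + 1)) (coldExt₁ v) W))
        ∂(Measure.pi fun _ : ColdFreeIdx H => haarProbability (Matrix.specialUnitaryGroup (Fin 2) ℂ)) =
      (∫⁻ w, ENNReal.ofReal ((coldGoodSet β ε H).indicator Ψ (chartCfgD ϑ w) *
          Real.exp (-β * wilsonBoundaryAction (fundamentalRep (Fin 2)) (boxEdges 4 (2 * H + 1)) (chartCfgD ϑ w))) *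
          ∏ e, gnomonicDensity (w e) ∂(Measure.pi fun _ : ColdFreeIdx H => (volume : Measure (Fin 3 → ℝ)))).toReal := by
  have hSm : Measurable fun U : LGConfig 4 (Matrix.specialUnitaryGroup (Fin 2) ℂ) =>
      Real.exp (-β * wilsonBoundaryAction (fundamentalRep (Fin 2)) (boxEdges 4 (2 * H + 1)) U) :=
    (Real.continuous_exp.comp (continuous_const.mul (continuous_wilsonBoundaryAction _ (continuous_fundamentalRep (Fin 2)) _))).measurable
  have hUm : Measurable fun v : ColdFreeCfg (G := Matrix.specialUnitaryGroup (Fin 2) ℂ) H =>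
      glueWith (boxEdges 4 (2 * H + 1)) (coldExt₁ v) W :=
    (measurable_glueWith _ _).comp measurable_coldExt₁
  set f : LGConfig 4 (Matrix.specialUnitaryGroup (Fin 2) ℂ) → ℝ := fun U => (coldGoodSet β ε H).indicator Ψ U *
    Real.exp (-β * wilsonBoundaryAction (fundamentalRep (Fin 2)) (boxEdges 4 (2 * H + 1)) U) with hf
  have hfm : Measurable f := (hΨm.indicator (measurableSet_coldGoodSet β ε H)).mul hSm
  have hf0 : ∀ U, 0 ≤ f U := fun U => mul_nonneg (Set.indicator_nonneg (fun _ _ => hΨ0 _) _) (Real.exp_pos _).le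
  rw [show (∫ v, (coldGoodSet β ε H).indicator Ψ (glueWith (boxEdges 4 (2 * H + 1)) (coldExt₁ v) W) *
      Real.exp (-β * wilsonBoundaryAction (fundamentalRep (Fin 2)) (boxEdges 4 (2 * H + 1))
        (glueWith (boxEdges 4 (2 * H + 1)) (coldExt₁ v) W))
      ∂(Measure.pi fun _ : ColdFreeIdx H => haarProbability (Matrix.specialUnitaryGroup (Fin 2) ℂ))) =
      ∫ v, f (glueWith (boxEdges 4 (2 * H + 1)) (coldExt₁ v) W)
        ∂(Measure.pi fun _ : ColdFreeIdx H => haarProbability (Matrix.specialUnitaryGroup (Fin 2) ℂ)) from rfl,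
    integral_eq_lintegral_of_nonneg_ae (ae_of_all _ fun v => hf0 _) ((hfm.comp hUm).aestronglyMeasurable)]
  congr 1
  have key := lintegral_pi_haar_eq_gnomonic (ι := ColdFreeIdx H)
    (fun v => ENNReal.ofReal (f (glueWith (boxEdges 4 (2 * H + 1)) (coldExt₁ v) W)))
    (ENNReal.measurable_ofReal.comp (hfm.comp hUm)) (by
      intro v hv
      obtain ⟨e, he⟩ := hv
      have hnot : glueWith (boxEdges 4 (2 * H + 1)) (coldExt₁ v) W ∉ coldGoodSet β ε H := fun hmem =>
        absurd (re_trace_pos_of_mem_coldGoodSet_datum hβ hH hr hwin hW hϑ v hmem e) (not_lt.2 he)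
      simp [hf, Set.indicator_of_notMem hnot])
  rw [key]
  refine lintegral_congr fun w => ?_
  simp only [hf, glueWith_coldExt₁_gnomonicChart ϑ hW]

/-! ## Step 3 (datum): translation + scaling, the density identity with datum, and the Gaussian reference -/

/-- **Change of variables with a translation**: for `β > 0` there is `a ∈ (0,∞)` with
`∫⁻ F(w) dw = a · ∫⁻ F(unscaleT β (t + μ')) dt` for every measurable `F ≥ 0` and every fixed `μ'` (constant Jacobian of the scaling,
translation invariance of Lebesgue measure). -/
theorem exists_lintegral_eq_mul_lintegral_unscaleT_add {β : ℝ} (hβ : 0 < β) :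
    ∃ a : ℝ≥0∞, a ≠ 0 ∧ a ≠ ∞ ∧ ∀ m : TSpace H, ∀ F : (ColdFreeIdx H → (Fin 3 → ℝ)) → ℝ≥0∞, Measurable F →
      ∫⁻ w, F w ∂(volume : Measure (ColdFreeIdx H → (Fin 3 → ℝ))) =
        a * ∫⁻ t, F (unscaleT H β (t + m)) ∂(volume : Measure (TSpace H)) := by
  obtain ⟨a, ha0, hatop, ha⟩ := exists_lintegral_eq_mul_lintegral_unscaleT (H := H) hβ
  refine ⟨a, ha0, hatop, fun m F hF => ?_⟩
  rw [ha F hF]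
  congr 1
  exact (lintegral_add_right_eq_self (μ := (volume : Measure (TSpace H))) (fun t => F (unscaleT H β t)) m).symm

/-- **Step 3 (datum).**  For measurable `Ψ ≥ 0`: the chart integral of Step 2 equals `a · C · Z³ · ∫⁻ 𝟙_{goodTD}(t) Ψ(cfgTD t) e^{tiltWD t} d(gauss3 H)`,
with the Jacobian constant `a` and the completed-square constant `C` of the datum. -/
theorem lintegral_chartD_eq_const_mul_lintegral_gauss3 {β ε : ℝ} (ϑ : Fin 3 → (Literature.MathematicalPhysics.QuantumLattice.ZdEdge 4 → ℝ))
    {Ψ : LGConfig 4 (Matrix.specialUnitaryGroup (Fin 2) ℂ) → ℝ} (hΨm : Measurable Ψ) (hΨ0 : ∀ U, 0 ≤ Ψ U)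
    {a : ℝ≥0∞} (ha : ∀ F : (ColdFreeIdx H → (Fin 3 → ℝ)) → ℝ≥0∞, Measurable F →
      ∫⁻ w, F w ∂(volume : Measure (ColdFreeIdx H → (Fin 3 → ℝ))) =
        a * ∫⁻ t, F (unscaleT H β (t + meanT H β ϑ)) ∂(volume : Measure (TSpace H)))
    {C : ℝ≥0∞} (hC : ∀ t : TSpace H,
      ENNReal.ofReal (Real.exp (-β * wilsonBoundaryAction (fundamentalRep (Fin 2)) (boxEdges 4 (2 * H + 1)) (cfgTD H β ϑ t))) *
          ∏ e : ColdFreeIdx H, gnomonicDensity (unscaleT H β (t + meanT H β ϑ) e) =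
        C * (∏ i, gaussWeight (Qmat (fun e => e ∉ dirFreeEdges H) dirCorner (2 * H + 3)) (t i)) *
          ENNReal.ofReal (Real.exp (tiltWD H β ϑ t))) :
    ∫⁻ w, ENNReal.ofReal ((coldGoodSet β ε H).indicator Ψ (chartCfgD ϑ w) *
          Real.exp (-β * wilsonBoundaryAction (fundamentalRep (Fin 2)) (boxEdges 4 (2 * H + 1)) (chartCfgD ϑ w))) *
          ∏ e, gnomonicDensity (w e) ∂(Measure.pi fun _ : ColdFreeIdx H => (volume : Measure (Fin 3 → ℝ))) =
      a * C * gaussZ (Qmat (fun e => e ∉ dirFreeEdges H) dirCorner (2 * H + 3)) ^ 3 *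
        ∫⁻ t, ENNReal.ofReal ((goodTD H β ε ϑ).indicator (fun t => Ψ (cfgTD H β ϑ t) * Real.exp (tiltWD H β ϑ t)) t) ∂(gauss3 H) := by
  have hSm : Measurable fun U : LGConfig 4 (Matrix.specialUnitaryGroup (Fin 2) ℂ) =>
      Real.exp (-β * wilsonBoundaryAction (fundamentalRep (Fin 2)) (boxEdges 4 (2 * H + 1)) U) :=
    (Real.continuous_exp.comp (continuous_const.mul (continuous_wilsonBoundaryAction _ (continuous_fundamentalRep (Fin 2)) _))).measurable
  have hind : Measurable fun U : LGConfig 4 (Matrix.specialUnitaryGroup (Fin 2) ℂ) => (coldGoodSet β ε H).indicator Ψ U :=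
    hΨm.indicator (measurableSet_coldGoodSet β ε H)
  have hdens : Measurable fun w : ColdFreeIdx H → (Fin 3 → ℝ) => ∏ e, gnomonicDensity (w e) :=
    Finset.measurable_prod _ fun e _ => measurable_gnomonicDensity.comp (measurable_pi_apply e)
  have hF : Measurable fun w : ColdFreeIdx H → (Fin 3 → ℝ) => ENNReal.ofReal ((coldGoodSet β ε H).indicator Ψ (chartCfgD ϑ w) *
      Real.exp (-β * wilsonBoundaryAction (fundamentalRep (Fin 2)) (boxEdges 4 (2 * H + 1)) (chartCfgD ϑ w))) *
      ∏ e, gnomonicDensity (w e) :=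
    (ENNReal.measurable_ofReal.comp ((hind.comp (measurable_chartCfgD ϑ)).mul (hSm.comp (measurable_chartCfgD ϑ)))).mul hdens
  rw [← volume_pi, ha _ hF]
  have hpt : ∀ t : TSpace H, ENNReal.ofReal ((coldGoodSet β ε H).indicator Ψ (chartCfgD ϑ (unscaleT H β (t + meanT H β ϑ))) *
      Real.exp (-β * wilsonBoundaryAction (fundamentalRep (Fin 2)) (boxEdges 4 (2 * H + 1))
        (chartCfgD ϑ (unscaleT H β (t + meanT H β ϑ))))) *
      ∏ e, gnomonicDensity (unscaleT H β (t + meanT H β ϑ) e) =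
      C * (ENNReal.ofReal ((goodTD H β ε ϑ).indicator (fun t => Ψ (cfgTD H β ϑ t) * Real.exp (tiltWD H β ϑ t)) t) *
          ∏ i, gaussWeight (Qmat (fun e => e ∉ dirFreeEdges H) dirCorner (2 * H + 3)) (t i)) := by
    intro t
    have hcfg : chartCfgD ϑ (unscaleT H β (t + meanT H β ϑ)) = cfgTD H β ϑ t := rfl
    rw [hcfg, ENNReal.ofReal_mul (Set.indicator_nonneg (fun _ _ => hΨ0 _) _), mul_assoc, hC t]
    by_cases ht : t ∈ goodTD H β ε ϑ
    · have hU : cfgTD H β ϑ t ∈ coldGoodSet β ε H := ht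
      rw [Set.indicator_of_mem hU, Set.indicator_of_mem ht, ENNReal.ofReal_mul (hΨ0 _)]
      ring
    · have hU : cfgTD H β ϑ t ∉ coldGoodSet β ε H := ht
      rw [Set.indicator_of_notMem hU, Set.indicator_of_notMem ht]
      simp
  simp_rw [hpt]
  have hg : Measurable fun t : TSpace H =>
      ENNReal.ofReal ((goodTD H β ε ϑ).indicator (fun t => Ψ (cfgTD H β ϑ t) * Real.exp (tiltWD H β ϑ t)) t) :=
    ENNReal.measurable_ofReal.comp ((((hΨm.comp (measurable_cfgTD β ϑ)).mul
      (Real.measurable_exp.comp (measurable_tiltWD β ϑ))).indicator (measurableSet_goodTD β ε ϑ)))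
  have hm2 : Measurable fun t : TSpace H =>
      ENNReal.ofReal ((goodTD H β ε ϑ).indicator (fun t => Ψ (cfgTD H β ϑ t) * Real.exp (tiltWD H β ϑ t)) t) *
        ∏ i, gaussWeight (Qmat (fun e => e ∉ dirFreeEdges H) dirCorner (2 * H + 3)) (t i) :=
    hg.mul (Finset.measurable_prod _ fun i _ => (measurable_gaussWeight _).comp (measurable_pi_apply i))
  rw [lintegral_const_mul _ hm2, lintegral_mul_prod_gaussWeight_eq _ hg]
  ring

/-! ## T3 — the representation with datum -/

/-- **T3 — THE REPRESENTATION WITH DATUM.**  Let `W` be an exterior datum whose links off the cold box `Λ = boxEdges 4 (2H+1)` are chart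
points `W e = P(1, ϑ_e)` with `Σ_c ϑ_{c,e}² ≤ r²`, inside the window `(12H²+2H+1)(√(β^{2ε−1}) + 8r) ≤ 1` (`β > 0`, `H ≥ 1`, `r ≥ 0`), and
assume `γ_Λ(·|W)(G) ≠ 0`, `gauss3(goodTD) ≠ 0` (`G = coldGoodSet β ε H`).  Then for every measurable gauge-invariant `X ≥ 0`, the DLR box
kernel conditioned on the small-field event is the `e^{tiltWD}`-tilt of the conditioned, UNshifted product Dirichlet Gaussian read through
the chart configuration with datum (the harmonic mean shift `μ' = mean ϑ'` sits inside `cfgTD`):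
`∫ X d(γ_Λ(·|W)[|G]) = ∫ X(cfgTD β ϑ t) d(((gauss3 H)[|goodTD]).tilted (𝟙_{goodTD}·tiltWD))`.
The flat theorem `integral_cond_boxState_eq_integral_tilted` is the case `W ≡ 1`, `ϑ = 0`.  (No hypothesis on the forest values of `ϑ` is
needed here — `extDatum` ignores them; they enter only the SIZE of the tilt, `abs_tiltWD_le_of_mem_goodTD`.) -/
theorem integral_cond_boxKernel_eq_integral_tilted_datum {β ε r : ℝ} (hβ : 0 < β) (hH : 1 ≤ H) (hr : 0 ≤ r)
    (hwin : (12 * (H : ℝ) ^ 2 + 2 * H + 1) * (Real.sqrt (β ^ (2 * ε - 1)) + 8 * r) ≤ 1)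
    {W : LGConfig 4 (Matrix.specialUnitaryGroup (Fin 2) ℂ)} {ϑ : Fin 3 → (Literature.MathematicalPhysics.QuantumLattice.ZdEdge 4 → ℝ)}
    (hW : ∀ e, e ∉ boxEdges 4 (2 * H + 1) → W e = gnomonicChart (fun c => ϑ c e))
    (hϑ : ∀ e, e ∉ boxEdges 4 (2 * H + 1) → ∑ c, ϑ c e ^ 2 ≤ r ^ 2)
    (hG0 : boxKernel β H W (coldGoodSet β ε H) ≠ 0) (hγ : gauss3 H (goodTD H β ε ϑ) ≠ 0)
    {X : LGConfig 4 (Matrix.specialUnitaryGroup (Fin 2) ℂ) → ℝ} (hXm : Measurable X) (hXinv : IsZdGaugeInvariant X)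
    (hX0 : ∀ U, 0 ≤ X U) :
    ∫ U, X U ∂((boxKernel β H W)[|coldGoodSet β ε H]) =
      ∫ t, X (cfgTD H β ϑ t) ∂(((gauss3 H)[|goodTD H β ε ϑ]).tilted ((goodTD H β ε ϑ).indicator (tiltWD H β ϑ))) := by
  obtain ⟨a, ha0, hatop, ha⟩ := exists_lintegral_eq_mul_lintegral_unscaleT_add (H := H) hβ
  obtain ⟨C, hC0, hCtop, hC⟩ := exists_boltzmann_mul_gnomonicDensity_datum_eq (H := H) β ϑ
  rw [integral_tilted_cond_eq_ratio (gauss3 H) (measurableSet_goodTD β ε ϑ) hγ (measurable_tiltWD β ϑ)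
      (φ := fun t => X (cfgTD H β ϑ t)) (hXm.comp (measurable_cfgTD β ϑ)) (fun t => hX0 _),
    integral_cond_boxKernel_eq_ratio β ε H W hG0 hXm hXinv,
    freeIntegral_indicator_eq_lintegral_chart_datum hβ hH hr hwin hW hϑ hXm hX0,
    freeIntegral_indicator_eq_lintegral_chart_datum hβ hH hr hwin hW hϑ measurable_const (fun _ => zero_le_one),
    lintegral_chartD_eq_const_mul_lintegral_gauss3 ϑ hXm hX0 (ha (meanT H β ϑ)) hC,
    lintegral_chartD_eq_const_mul_lintegral_gauss3 ϑ measurable_const (fun _ => zero_le_one) (ha (meanT H β ϑ)) hC]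
  simp only [one_mul, ENNReal.toReal_mul]
  obtain ⟨-, hZ0, hZtop⟩ := boxDirichlet_eq_withDensity H
  have hK : a.toReal * C.toReal * (gaussZ (Qmat (fun e => e ∉ dirFreeEdges H) dirCorner (2 * H + 3)) ^ 3).toReal ≠ 0 :=
    mul_ne_zero (mul_ne_zero (ENNReal.toReal_ne_zero.2 ⟨ha0, hatop⟩) (ENNReal.toReal_ne_zero.2 ⟨hC0, hCtop⟩))
      (ENNReal.toReal_ne_zero.2 ⟨pow_ne_zero _ hZ0, ENNReal.pow_ne_top hZtop⟩)
  rw [mul_div_mul_left _ _ hK]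

end Summit.QuantumFields.YangMills.Theorems.WeakCouplingRates

end
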